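import Summits.AtomisticToContinuum.Crystallization.Theorems.FrustratedLawDichotomyCornerPairing
import Summits.AtomisticToContinuum.Crystallization.Theorems.FrustratedLawDichotomyBondGraphWindows

/-!
# FrustratedLawDichotomy · crux `AperiodicFrustratedLawGap` (stmt-AtomisticToContinuum-27623) — THE ℚ-MIRROR OF «NO TWIST»:
# the metric half of P `CapForcing` at a corner, as a FINITE two-link statement (decomp-a2c, prover hand 2, gen 9)

P's corner step (lens-5 g29 NODE §4; CORNER PAIRING I/II, p821792/p821922): at a corner `w` of a square `{a, w, b, w''}` of the link of `i`,
the neighbour `j = τ w` has its own classified link (`τ' : Pat' → …`, `τ' w' = i`), and the correspondence `C'(w') ↔ C(w)` of the four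
common sites either respects the square diagonals (CRYSTAL) or not (TWISTED).  At path-type (`3².4²`) corners crystal is forced
combinatorially (p821792); at matching-type corners (every fcc corner, six hcp corners) the twist must be excluded METRICALLY.  This file
types that exclusion as a FINITE statement and reduces the configuration statement to it:

`NoTwistCert θ Pat Pat'` := for all `p : Pat → ℝ³` (link of the centre `0`), `s : Pat' → ℝ³` (link of the neighbour `p w`, positions
relative to the centre, unit `nn_i = 1`), `w : Pat`, `w' : Pat'` with `s w' = 0`, satisfying — on the cluster `K = {0} ∪ range p ∪ range s` —
radial windows, injectivity, the identification of the four common sites (`s '' C'(w') = p '' C(w)`, and `s x = p u ⇒ u ∈ C(w), x ∈ C'(w')`),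
COUPLED windows for every known bond (`0–p u`, `Pat`-contacts, `p w–s x`, `Pat'`-contacts), NON-BOND strictness for every known non-bond
(`Pat`-non-contacts, `Pat'`-non-contacts, `0–s x` for `s x ∉ range p`), and for the undetermined pairs `p u–s x` the DISJUNCTION
«coupled bond window ∨ non-bond strictness»:  every `Pat`-DIAGONAL pair `{a, b} ⊆ C(w)` corresponds to a `Pat'`-DIAGONAL pair.

* `noTwist_of_cert` : `NoTwistCert θ Pat Pat' →` (contact graphs of `Pat`, `Pat'` separate points) `→` for every injective configuration with
  `LinkIso θ Pat y i τ`, `LinkIso θ Pat' y (τ w) τ'`, `τ' w' = i`: `τ' a' = τ a → τ' b' = τ b → dist w a = 1 → dist w b = 1 → dist a b = √2 →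
  dist a' b' = √2`.
With CORNER PAIRING II's construction this turns every corner into a half-cap; the remaining «cap match» (the half-caps from the two
corners of a square coincide) is the last metric piece of P.  `[folklore]` bookkeeping; no `sorry`; no `instance`/`notation`.
-/

noncomputable section

namespace Summit.AtomisticToContinuum.Crystallization.Theorems.FrustratedLawDichotomyNoTwistCert

open Literature.Geometry.DiscreteGeometry
open Summit.AtomisticToContinuum.Crystallization.Theorems.FrustratedLawDichotomyTwoShellRigidityCut (E3 LinkIso)
open Summit.AtomisticToContinuum.Crystallization.Theorems.FrustratedLawDichotomyLinkIsoToolkit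
  (injective_of_linkIso image_contacts_eq_of_shared_bond)
open Summit.AtomisticToContinuum.Crystallization.Theorems.FrustratedLawDichotomyBondGraphWindows
  (one_add_pos_of_adj dist_le_mul_dist_of_adj dist_le_mul_dist_of_adj' min_dist_lt_dist_of_not_adj)

/-- The coupled bond window between two named points `X ∼ Y` of a cluster `K`, at tolerance `θ` (both ends). -/
def BondLike (θ : ℝ) (K : Set E3) (X Y : E3) : Prop :=
  (∀ Z ∈ K, Z ≠ X → ‖X - Y‖ ≤ (1 + θ) * ‖X - Z‖) ∧ (∀ Z ∈ K, Z ≠ Y → ‖X - Y‖ ≤ (1 + θ) * ‖Y - Z‖)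

/-- **`NoTwistCert θ Pat Pat'` — the finite «no twist» statement** (see the module docstring). [certificate target; lens-5 NODE §4: the
twisted pairing puts a thirteenth site within `1.18·nn_i` of the centre, against the `46.2° < 52.5°` covering margin at `θ = 1/100`] -/
def NoTwistCert (θ : ℝ) (Pat Pat' : Finset E3) : Prop :=
  ∀ (p : ↥Pat → E3) (s : ↥Pat' → E3) (w : ↥Pat) (w' : ↥Pat'),
    s w' = 0 →
    -- radial windows of both links, injectivity, distinctness from the own centre
    (∀ u : ↥Pat, 1 ≤ ‖p u‖ ∧ ‖p u‖ ≤ 1 + θ) → Function.Injective p → Function.Injective s → (∀ x : ↥Pat', s x ≠ p w) →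
    -- the four common sites
    (∀ x : ↥Pat', dist (w' : E3) (x : E3) = 1 → ∃ a : ↥Pat, dist (w : E3) (a : E3) = 1 ∧ s x = p a) →
    (∀ a : ↥Pat, dist (w : E3) (a : E3) = 1 → ∃ x : ↥Pat', dist (w' : E3) (x : E3) = 1 ∧ p a = s x) →
    (∀ (x : ↥Pat') (u : ↥Pat), s x = p u → dist (w : E3) (u : E3) = 1 ∧ dist (w' : E3) (x : E3) = 1) →
    -- coupled windows for the known bonds
    (∀ u : ↥Pat, BondLike θ (insert 0 (Set.range p ∪ Set.range s)) 0 (p u)) →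
    (∀ u v : ↥Pat, dist (u : E3) (v : E3) = 1 → BondLike θ (insert 0 (Set.range p ∪ Set.range s)) (p u) (p v)) →
    (∀ x : ↥Pat', BondLike θ (insert 0 (Set.range p ∪ Set.range s)) (p w) (s x)) →
    (∀ x x' : ↥Pat', dist (x : E3) (x' : E3) = 1 → BondLike θ (insert 0 (Set.range p ∪ Set.range s)) (s x) (s x')) →
    -- strictness for the known non-bonds
    (∀ u v : ↥Pat, u ≠ v → dist (u : E3) (v : E3) ≠ 1 → min ‖p u‖ ‖p v‖ < ‖p u - p v‖) →
    (∀ x x' : ↥Pat', x ≠ x' → dist (x : E3) (x' : E3) ≠ 1 → min ‖s x - p w‖ ‖s x' - p w‖ < ‖s x - s x'‖) →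
    (∀ x : ↥Pat', s x ∉ Set.range p → s x ≠ 0 → ∀ u : ↥Pat, min ‖p u‖ ‖s x - p w‖ < ‖s x‖) →
    -- the undetermined pairs: bond window or non-bond strictness
    (∀ (u : ↥Pat) (x : ↥Pat'), s x ≠ p u → u ≠ w →
      BondLike θ (insert 0 (Set.range p ∪ Set.range s)) (p u) (s x) ∨ min ‖p u‖ ‖s x - p w‖ < ‖p u - s x‖) →
    -- conclusion: diagonals of the centre's corner correspond to diagonals of the neighbour's corner
    ∀ (a b : ↥Pat) (a' b' : ↥Pat'), dist (w : E3) (a : E3) = 1 → dist (w : E3) (b : E3) = 1 → s a' = p a → s b' = p b →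
      dist (a : E3) (b : E3) = Real.sqrt 2 → dist (a' : E3) (b' : E3) = Real.sqrt 2

/-- **THE REDUCTION**: `NoTwistCert θ Pat Pat'` gives the configuration statement «no twisted corner» for every injective configuration with
a `Pat`-classified link at `i` and a `Pat'`-classified link at the corner `τ w` (`τ' w' = i`). [folklore] -/
theorem noTwist_of_cert {θ : ℝ} {Pat Pat' : Finset E3}
    (hPat : ∀ u v : ↥Pat, u ≠ v → ∃ c : ↥Pat, dist (u : E3) (c : E3) = 1 ∧ dist (v : E3) (c : E3) ≠ 1)
    (hPat' : ∀ u v : ↥Pat', u ≠ v → ∃ c : ↥Pat', dist (u : E3) (c : E3) = 1 ∧ dist (v : E3) (c : E3) ≠ 1)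
    (hcert : NoTwistCert θ Pat Pat')
    {N : ℕ} {y : Fin N → E3} {i : Fin N} {τ : ↥Pat → Fin N} {τ' : ↥Pat' → Fin N} (hy : Function.Injective y)
    (hL : LinkIso θ Pat y i τ) (w : ↥Pat) (hL' : LinkIso θ Pat' y (τ w) τ') {w' : ↥Pat'} (hw' : τ' w' = i)
    {a b : ↥Pat} {a' b' : ↥Pat'} (ha : dist (w : E3) (a : E3) = 1) (hb : dist (w : E3) (b : E3) = 1)
    (ha' : τ' a' = τ a) (hb' : τ' b' = τ b) (hab : dist (a : E3) (b : E3) = Real.sqrt 2) :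
    dist (a' : E3) (b' : E3) = Real.sqrt 2 := by
  classical
  have hτ : Function.Injective τ := injective_of_linkIso hPat hL
  have hτ' : Function.Injective τ' := injective_of_linkIso hPat' hL'
  have hadjw : (bondGraph θ y).Adj i (τ w) := hL.1 w
  have hθpos : 0 < 1 + θ := one_add_pos_of_adj hy hadjw
  have hθ : 0 ≤ 1 + θ := hθpos.le
  -- the unit
  set r : ℝ := nearestDist y i with hr_def
  have hwi : τ w ≠ i := fun h => hadjw.ne h.symm
  have hr0 : 0 < r := by
    obtain ⟨k₀, hk₀, hr⟩ := exists_nearestDist_eq_dist y (j := i) ⟨τ w, hwi⟩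
    rw [hr_def, hr]
    exact dist_pos.2 fun h => hk₀ (hy h).symm
  have hri : 0 < r⁻¹ := inv_pos.2 hr0
  -- rescaled positions
  set q : Fin N → E3 := fun j => r⁻¹ • (y j - y i) with hq_def
  have hq_sub : ∀ j l, ‖q j - q l‖ = r⁻¹ * dist (y j) (y l) := by
    intro j l
    simp only [hq_def]
    rw [← smul_sub, sub_sub_sub_cancel_right, norm_smul, Real.norm_of_nonneg hri.le, dist_eq_norm]
  have hqi : q i = 0 := by simp [hq_def]
  have hq_norm : ∀ j, ‖q j‖ = r⁻¹ * dist (y j) (y i) := by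
    intro j
    have := hq_sub j i
    rwa [hqi, sub_zero] at this
  have hq_inj : Function.Injective q := by
    intro j l h
    have h0 : ‖q j - q l‖ = 0 := by rw [h, sub_self, norm_zero]
    rw [hq_sub] at h0
    rcases mul_eq_zero.1 h0 with h1 | h1
    · exact absurd h1 hri.ne'
    · exact hy (dist_eq_zero.1 h1)
  -- scaled forms of the window facts
  have sA : ∀ j, j ≠ i → 1 ≤ ‖q j‖ := by
    intro j hj
    rw [hq_norm, dist_comm]
    have := nearestDist_le_dist y hj
    rw [← hr_def] at this
    calc (1 : ℝ) = r⁻¹ * r := by field_simp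
      _ ≤ r⁻¹ * dist (y i) (y j) := mul_le_mul_of_nonneg_left this hri.le
  have sR : ∀ j, (bondGraph θ y).Adj i j → ‖q j‖ ≤ 1 + θ := by
    intro j hj
    rw [hq_norm, dist_comm]
    have h1 : dist (y i) (y j) ≤ (1 + θ) * r := dist_le_of_adj hθ hj
    calc r⁻¹ * dist (y i) (y j) ≤ r⁻¹ * ((1 + θ) * r) := mul_le_mul_of_nonneg_left h1 hri.le
      _ = 1 + θ := by field_simp
  have sB : ∀ j k l, (bondGraph θ y).Adj j k → l ≠ j → ‖q j - q k‖ ≤ (1 + θ) * ‖q j - q l‖ := by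
    intro j k l hjk hlj
    rw [hq_sub, hq_sub]
    calc r⁻¹ * dist (y j) (y k) ≤ r⁻¹ * ((1 + θ) * dist (y j) (y l)) :=
          mul_le_mul_of_nonneg_left (dist_le_mul_dist_of_adj hθ hjk hlj) hri.le
      _ = (1 + θ) * (r⁻¹ * dist (y j) (y l)) := by ring
  have sB' : ∀ j k l, (bondGraph θ y).Adj j k → l ≠ k → ‖q j - q k‖ ≤ (1 + θ) * ‖q k - q l‖ := by
    intro j k l hjk hlk
    rw [norm_sub_rev (q j)]
    exact sB k j l hjk.symm hlk
  have sN : ∀ j k j' k', j ≠ k → ¬ (bondGraph θ y).Adj j k → (bondGraph θ y).Adj j j' → (bondGraph θ y).Adj k k' →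
      min ‖q j - q j'‖ ‖q k - q k'‖ < ‖q j - q k‖ := by
    intro j k j' k' hjk hnot hj hk
    rw [hq_sub, hq_sub, hq_sub, ← mul_min_of_nonneg _ _ hri.le]
    exact mul_lt_mul_of_pos_left (min_dist_lt_dist_of_not_adj hθ hjk hnot hj hk) hri
  -- the finite data
  set p : ↥Pat → E3 := fun u => q (τ u) with hp_def
  set s : ↥Pat' → E3 := fun x => q (τ' x) with hs_def
  set K : Set E3 := insert 0 (Set.range p ∪ Set.range s) with hK_def
  have hK : ∀ {Z} {j : Fin N}, Z ∈ K → Z ≠ q j → ∃ l, l ≠ j ∧ q l = Z := by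
    intro Z j hZ hne
    rcases hZ with rfl | hZ
    · exact ⟨i, fun h => hne (by rw [← h, hqi]), hqi⟩
    rcases hZ with ⟨u, rfl⟩ | ⟨x, rfl⟩
    · exact ⟨τ u, fun h => hne (by simp [hp_def, h]), rfl⟩
    · exact ⟨τ' x, fun h => hne (by simp [hs_def, h]), rfl⟩
  have bondLike : ∀ {j k : Fin N}, (bondGraph θ y).Adj j k → BondLike θ K (q j) (q k) := by
    intro j k hjk
    refine ⟨fun Z hZ hne => ?_, fun Z hZ hne => ?_⟩
    · obtain ⟨l, hl, rfl⟩ := hK hZ hne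
      exact sB j k l hjk hl
    · obtain ⟨l, hl, rfl⟩ := hK hZ hne
      exact sB' j k l hjk hl
  -- facts about the two links
  have hτi : ∀ u, τ u ≠ i := fun u h => (hL.1 u).ne h.symm
  have himg := image_contacts_eq_of_shared_bond hL w hL' hw'
  -- apply the certificate
  refine hcert p s w w' ?_ ?_ ?_ ?_ ?_ ?_ ?_ ?_ ?_ ?_ ?_ ?_ ?_ ?_ ?_ ?_ a b a' b' ha hb ?_ ?_ hab
  · -- s w' = 0
    simp [hs_def, hw', hqi]
  · exact fun u => ⟨sA _ (hτi u), sR _ (hL.1 u)⟩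
  · exact hq_inj.comp hτ
  · exact hq_inj.comp hτ'
  · intro x h
    exact (hL'.1 x).ne (hq_inj h).symm
  · -- s '' C'(w') ⊆ p '' C(w)
    intro x hx
    have : τ' x ∈ τ' '' {v' : ↥Pat' | dist (w' : E3) (v' : E3) = 1} := ⟨x, hx, rfl⟩
    rw [himg] at this
    obtain ⟨a₀, ha₀, hτa₀⟩ := this
    exact ⟨a₀, ha₀, by simp [hs_def, hp_def, hτa₀]⟩
  · -- p '' C(w) ⊆ s '' C'(w')
    intro a₀ ha₀
    have : τ a₀ ∈ τ '' {v : ↥Pat | dist (w : E3) (v : E3) = 1} := ⟨a₀, ha₀, rfl⟩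
    rw [← himg] at this
    obtain ⟨x, hx, hτx⟩ := this
    exact ⟨x, hx, by simp [hs_def, hp_def, hτx]⟩
  · -- coincidences s x = p u force u ∈ C(w), x ∈ C'(w')
    intro x u hxu
    have hsite : τ' x = τ u := hq_inj hxu
    have hadj_u : (bondGraph θ y).Adj (τ w) (τ u) := by rw [← hsite]; exact hL'.1 x
    have hwu : dist (w : E3) (u : E3) = 1 := (hL.2.2 w u).1 hadj_u
    have hadj_x : (bondGraph θ y).Adj (τ' w') (τ' x) := by rw [hw', hsite]; exact hL.1 u
    exact ⟨hwu, (hL'.2.2 w' x).1 hadj_x⟩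
  · -- bonds 0 – p u
    intro u
    have := bondLike (hL.1 u)
    rwa [hqi] at this
  · -- Pat-contacts
    intro u v huv
    exact bondLike ((hL.2.2 u v).2 huv)
  · -- p w – s x
    intro x
    exact bondLike (hL'.1 x)
  · -- Pat'-contacts
    intro x x' hxx
    exact bondLike ((hL'.2.2 x x').2 hxx)
  · -- Pat-non-contacts
    intro u v huv hd
    have hnot : ¬ (bondGraph θ y).Adj (τ u) (τ v) := fun h => hd ((hL.2.2 u v).1 h)
    have := sN (τ u) (τ v) i i (hτ.ne huv) hnot (hL.1 u).symm (hL.1 v).symm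
    simpa [hqi] using this
  · -- Pat'-non-contacts
    intro x x' hxx hd
    have hnot : ¬ (bondGraph θ y).Adj (τ' x) (τ' x') := fun h => hd ((hL'.2.2 x x').1 h)
    exact sN (τ' x) (τ' x') (τ w) (τ w) (hτ'.ne hxx) hnot (hL'.1 x).symm (hL'.1 x').symm
  · -- 0 – s x non-bond for s x outside the centre's link
    intro x hx hx0 u
    have hxi : τ' x ≠ i := by
      intro h
      apply hx0
      simp [hs_def, h, hqi]
    have hnot : ¬ (bondGraph θ y).Adj i (τ' x) := by
      intro h
      obtain ⟨u₀, hu₀⟩ := hL.2.1 _ h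
      exact hx ⟨u₀, by simp [hp_def, hs_def, hu₀]⟩
    have := sN i (τ' x) (τ u) (τ w) hxi.symm hnot (hL.1 u) (hL'.1 x).symm
    rw [hqi, zero_sub, norm_neg, zero_sub, norm_neg] at this
    simpa [hp_def, hs_def] using this
  · -- undetermined pairs p u – s x
    intro u x hne huw
    by_cases hadj : (bondGraph θ y).Adj (τ u) (τ' x)
    · exact Or.inl (bondLike hadj)
    · right
      have hsite : τ u ≠ τ' x := fun h => hne (by simp [hp_def, hs_def, h])
      have := sN (τ u) (τ' x) i (τ w) hsite hadj (hL.1 u).symm (hL'.1 x).symm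
      simpa [hqi] using this
  · -- s a' = p a
    simp [hs_def, hp_def, ha']
  · simp [hs_def, hp_def, hb']

end Summit.AtomisticToContinuum.Crystallization.Theorems.FrustratedLawDichotomyNoTwistCert

end
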